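import Summits.CriticalPhenomena.PercolationContinuityZ3.Theorems.Transplant.AutEndStateOrbitQuasi
import Summits.CriticalPhenomena.PercolationContinuityZ3.Theorems.Transplant.AutEndStateVirtuallyNilpotent
import HarnessLib

/-!
# What the quasi-step node would buy, BY NAME: continuity on quasi-step orbit data ⟹ Conjecture 4 for every Cayley graph of every finitely generated virtually
# nilpotent group (no named fact), for every quasi-transitive graph of polynomial growth (Trofimov), the Heisenberg target, and `U_s` — the whole of class C2

builds on p205010 (kernel theorem, internal audit signed; external expert review pending) — nothing in this file uses p205010.  CONDITIONAL on the node-shaped hypothesis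
`hQ` = «`θ_v(p_c) = 0` on every connected locally finite graph carrying an `AutChart.OrbitQDatum`» (the conclusion the planners' quasi-step rung N3-b would deliver;
NOT asserted, no `@[conjecture]` declared or edited); everything else is the tree's: `AutChart.conj4_endState_of_orbitQuasi` (this seat, p499017) composed with p4-g27/28's
end-state corollaries.  Lane `prim-bschramm`, seat `prim-bschramm-p3` gen 28 (design owner; P3-NILPOTENT §21: the C2 verdict's chain (3)–(5) as named theorems).
Helper file (`--supports stmt-CriticalPhenomena-4575 --as helper`); def-free.
[cite: BenjaminiSchramm1996, Conj. 4; §2 (Cayley graphs, almost transitive graphs)] [cite: Trofimov1985, Thm. 2] [cite: MilnorSolvableGrowth1968, Lemma 1]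
-/

noncomputable section

namespace Summit.CriticalPhenomena.PercolationContinuityZ3.Theorems.Transplant

open SimpleGraph Literature.Probability.LatticeModels Literature.Probability.Percolation
open Literature.Combinatorics.SimpleGraph (Trofimov1985_polynomialGrowthBlocks)
open scoped Classical

namespace AutChart

/-- **Quasi-step orbit continuity ⟹ Conjecture 4 for EVERY Cayley graph of EVERY finitely generated VIRTUALLY NILPOTENT group** (`p_c < 1 ⟹ θ_g(p_c) = 0`, every finite
generating set; NO named fact — the Milnor–Wolf lemma and the end-state input are kernel, p4 gen 22/27/28). [cite: BenjaminiSchramm1996, Conj. 4; §2 (Cayley graphs)] -/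
theorem conj4_cayley_virtuallyNilpotent_of_orbitQuasi
    (hQ : ∀ {W : Type} (G' : SimpleGraph W) [G'.LocallyFinite] {B : Type} [Group B] [MulAction B W], OrbitQDatum G' B →
      ∀ v : W, theta G' v (criticalProbIOf G' v) = 0)
    {Γ : Type} [Group Γ] (S : Finset Γ) (hS : Subgroup.closure (S : Set Γ) = ⊤) (N : Subgroup Γ) [N.FiniteIndex] [Group.IsNilpotent N] (g : Γ)
    (hpc : criticalProb (mulCayley (↑S : Set Γ)) g < 1) :
    theta (mulCayley (↑S : Set Γ)) g (criticalProbIOf (mulCayley (↑S : Set Γ)) g) = 0 :=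
  EndStateVirtNil.conj4_cayley_of_endState (conj4_endState_of_orbitQuasi hQ) S hS N g hpc

/-- **… the dichotomy on virtually nilpotent Cayley graphs**: `p_c = 1` everywhere (virtually cyclic) or `p_c < 1 ∧ θ(p_c) = 0` everywhere. [cite: BenjaminiSchramm1996, Conj. 4; Thm. 1] -/
theorem dichotomy_virtuallyNilpotent_of_orbitQuasi
    (hQ : ∀ {W : Type} (G' : SimpleGraph W) [G'.LocallyFinite] {B : Type} [Group B] [MulAction B W], OrbitQDatum G' B →
      ∀ v : W, theta G' v (criticalProbIOf G' v) = 0)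
    {Γ : Type} [Group Γ] (S : Finset Γ) (hS : Subgroup.closure (S : Set Γ) = ⊤) (N : Subgroup Γ) [N.FiniteIndex] [Group.IsNilpotent N] :
    (∀ g : Γ, criticalProb (mulCayley (↑S : Set Γ)) g = 1) ∨
      ∀ g : Γ, criticalProb (mulCayley (↑S : Set Γ)) g < 1 ∧ theta (mulCayley (↑S : Set Γ)) g (criticalProbIOf (mulCayley (↑S : Set Γ)) g) = 0 :=
  EndStateVirtNil.dichotomy_of_endState (conj4_endState_of_orbitQuasi hQ) S hS N

/-- **Quasi-step orbit continuity + Trofimov 1985 Thm 2 ⟹ Conjecture 4 for EVERY quasi-transitive graph of POLYNOMIAL GROWTH** (the whole of class C2).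
[cite: BenjaminiSchramm1996, Conj. 4] [cite: Trofimov1985, Thm. 2] -/
theorem conj4_polynomialGrowth_of_orbitQuasi (hT : Trofimov1985_polynomialGrowthBlocks)
    (hQ : ∀ {W : Type} (G' : SimpleGraph W) [G'.LocallyFinite] {B : Type} [Group B] [MulAction B W], OrbitQDatum G' B →
      ∀ v : W, theta G' v (criticalProbIOf G' v) = 0) :
    BenjaminiSchramm1996_conj4_polynomialGrowth :=
  conj4_polynomialGrowth_of_conj4_endState hT (conj4_endState_of_orbitQuasi hQ)

/-- **… in particular the Heisenberg target `HeisenbergCriticalContinuity`** (through Trofimov; the Heisenberg Cayley rows themselves are already unconditional).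
[cite: BenjaminiSchramm1996, Conj. 4] -/
theorem heisenberg_of_orbitQuasi (hT : Trofimov1985_polynomialGrowthBlocks)
    (hQ : ∀ {W : Type} (G' : SimpleGraph W) [G'.LocallyFinite] {B : Type} [Group B] [MulAction B W], OrbitQDatum G' B →
      ∀ v : W, theta G' v (criticalProbIOf G' v) = 0) :
    HeisenbergCriticalContinuity :=
  heisenberg_of_conj4_endState hT (conj4_endState_of_orbitQuasi hQ)

/-- **… and the scaled one-type node `U_s`** (already a theorem, p483212; recorded to show the rung sits ABOVE U_s in the ladder). [cite: BenjaminiSchramm1996, Conj. 4] -/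
theorem frmScaledNode₁_of_orbitQuasi
    (hQ : ∀ {W : Type} (G' : SimpleGraph W) [G'.LocallyFinite] {B : Type} [Group B] [MulAction B W], OrbitQDatum G' B →
      ∀ v : W, theta G' v (criticalProbIOf G' v) = 0) :
    SamePDropOfSkeletonFrmScaled₁ :=
  frmScaledNode₁_of_conj4_endState (conj4_endState_of_orbitQuasi hQ)

end AutChart

end Summit.CriticalPhenomena.PercolationContinuityZ3.Theorems.Transplant

end
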